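import Mathlib

/-!
# Area-law slaving, complex part 11 — CAUCHY ESTIMATES between nested stadia (the slip-bound inputs of parts 8–10)
# (`FilamentSkeletonRss`, child crux `TangentSkeletonNearStraight`, stmt-NavierStokesRegularity-28295, line
# `child_tangent_analytic_strip`, ∃-side of the registered stub `stub_analyticClosing`: the `StadiumAnalyticArea` conjunct)

The capstone `stadium_analytic_area_of_slip` (complex part 9) takes `‖w″‖ ≤ K₂` and `‖w′‖ ≤ M` on the thin stadium of half-width `hs`.
Along the scheme of the line the slip continuation is known on a WIDER stadium with a derivative bound only; the second-derivative bound
on the thinner stadium is the Cauchy estimate.  This file records it in the stadium vocabulary: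

* `closedBall_subset_stadium_double` — for `z` in the stadium of half-width `hs` (length parameter `L`, centre `cc`), the closed disc
  `B̄(z, hs)` lies in the stadium of half-width `2hs` with the same `L, cc`;
* `stadium_norm_deriv_le_of_norm_le` — `f` holomorphic on the `2hs`-stadium with `‖f‖ ≤ C` there ⇒ `‖f′‖ ≤ C/hs` on the `hs`-stadium;
* `stadium_norm_second_deriv_le` — `w` holomorphic on the `2hs`-stadium with `‖w′ − d‖ ≤ q` there ⇒ `‖w″‖ ≤ q/hs` and
  `‖w′‖ ≤ ‖d‖ + q` on the `hs`-stadium (so `K₂ = q/hs`, `M = ‖d‖ + q` in part 9; in crux scaling `q = O(1)`, `hs = cs√Γ`,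
  `K₂·(r₁ + hs) ≤ 1/4` reads `q·(r₁/(cs√Γ) + 1) ≤ 1/4`).

HONEST FRAMING: textbook complex analysis serving a HYPOTHETICAL filament skeleton on the NEGATIVE side of a MODEL route; no registered
stub is closed by this file and nothing here bears on Navier–Stokes regularity or blow-up.  `--supports stmt-NavierStokesRegularity-28295`.
-/

set_option linter.dupNamespace false

noncomputable section

namespace Summit.NavierStokesRegularity.NavierStokesRegularity.Theorems.AreaLawSlavingHolo

open Set Metric Filter Real
open scoped Topology

/-- The closed disc of radius `hs` around a point of the `hs`-stadium lies in the `2hs`-stadium. [folklore] -/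
theorem closedBall_subset_stadium_double {hs L cc : ℝ} {z : ℂ} (hz : z ∈ {z : ℂ | |z.im| < hs ∧ |z.re - cc| < L + hs}) :
    closedBall z hs ⊆ {ζ : ℂ | |ζ.im| < 2 * hs ∧ |ζ.re - cc| < L + 2 * hs} := by
  intro ζ hζ
  rw [mem_closedBall, dist_eq_norm] at hζ
  have him : |ζ.im - z.im| ≤ hs := by
    have h := Complex.abs_im_le_norm (ζ - z)
    rw [Complex.sub_im] at h
    exact h.trans hζ
  have hre : |ζ.re - z.re| ≤ hs := by
    have h := Complex.abs_re_le_norm (ζ - z)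
    rw [Complex.sub_re] at h
    exact h.trans hζ
  constructor
  · calc |ζ.im| = |(ζ.im - z.im) + z.im| := by ring_nf
      _ ≤ |ζ.im - z.im| + |z.im| := abs_add_le _ _
      _ < 2 * hs := by linarith [hz.1]
  · calc |ζ.re - cc| = |(ζ.re - z.re) + (z.re - cc)| := by ring_nf
      _ ≤ |ζ.re - z.re| + |z.re - cc| := abs_add_le _ _
      _ < L + 2 * hs := by linarith [hz.2]

/-- **Cauchy estimate between nested stadia.**  `f` holomorphic on the `2hs`-stadium with `‖f‖ ≤ C` there; then `‖f′ z‖ ≤ C/hs` at every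
point `z` of the `hs`-stadium. [folklore: Cauchy] -/
theorem stadium_norm_deriv_le_of_norm_le {E : Type*} [NormedAddCommGroup E] [NormedSpace ℂ E] {hs L cc C : ℝ} {f : ℂ → E}
    (hf : DifferentiableOn ℂ f {ζ : ℂ | |ζ.im| < 2 * hs ∧ |ζ.re - cc| < L + 2 * hs})
    (hC : ∀ ζ ∈ {ζ : ℂ | |ζ.im| < 2 * hs ∧ |ζ.re - cc| < L + 2 * hs}, ‖f ζ‖ ≤ C)
    {z : ℂ} (hz : z ∈ {z : ℂ | |z.im| < hs ∧ |z.re - cc| < L + hs}) : ‖deriv f z‖ ≤ C / hs := by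
  have hhs : 0 < hs := lt_of_le_of_lt (abs_nonneg _) hz.1
  have hsub := closedBall_subset_stadium_double hz
  have hd : DiffContOnCl ℂ f (ball z hs) := hf.diffContOnCl_ball hsub
  exact Complex.norm_deriv_le_of_forall_mem_sphere_norm_le hhs hd
    (fun ζ hζ => hC ζ (hsub (sphere_subset_closedBall hζ)))

/-- **Second-derivative bound of the slip on the thin stadium.**  `w` holomorphic on the `2hs`-stadium with `‖w′ − d‖ ≤ q` there; then on
the `hs`-stadium `‖w″‖ ≤ q/hs` and `‖w′‖ ≤ ‖d‖ + q`. [folklore: Cauchy] -/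
theorem stadium_norm_second_deriv_le {hs L cc q : ℝ} {d : ℂ} {w : ℂ → ℂ}
    (hw : DifferentiableOn ℂ w {ζ : ℂ | |ζ.im| < 2 * hs ∧ |ζ.re - cc| < L + 2 * hs})
    (hq : ∀ ζ ∈ {ζ : ℂ | |ζ.im| < 2 * hs ∧ |ζ.re - cc| < L + 2 * hs}, ‖deriv w ζ - d‖ ≤ q) :
    ∀ z ∈ {z : ℂ | |z.im| < hs ∧ |z.re - cc| < L + hs}, ‖deriv (deriv w) z‖ ≤ q / hs ∧ ‖deriv w z‖ ≤ ‖d‖ + q := by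
  have hSo : IsOpen {ζ : ℂ | |ζ.im| < 2 * hs ∧ |ζ.re - cc| < L + 2 * hs} := by
    have h1 : IsOpen {ζ : ℂ | |ζ.im| < 2 * hs} := isOpen_lt (continuous_abs.comp Complex.continuous_im) continuous_const
    have h2 : IsOpen {ζ : ℂ | |ζ.re - cc| < L + 2 * hs} :=
      isOpen_lt (continuous_abs.comp (Complex.continuous_re.sub continuous_const)) continuous_const
    exact h1.inter h2
  have hw' : DifferentiableOn ℂ (deriv w) {ζ : ℂ | |ζ.im| < 2 * hs ∧ |ζ.re - cc| < L + 2 * hs} :=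
    (hw.analyticOnNhd hSo).deriv.differentiableOn
  have hg : DifferentiableOn ℂ (fun ζ => deriv w ζ - d) {ζ : ℂ | |ζ.im| < 2 * hs ∧ |ζ.re - cc| < L + 2 * hs} :=
    hw'.sub_const d
  intro z hz
  have hzS : z ∈ {ζ : ℂ | |ζ.im| < 2 * hs ∧ |ζ.re - cc| < L + 2 * hs} :=
    closedBall_subset_stadium_double hz (mem_closedBall_self (lt_of_le_of_lt (abs_nonneg _) hz.1).le)
  constructor
  · have h := stadium_norm_deriv_le_of_norm_le (f := fun ζ => deriv w ζ - d) hg hq hz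
    have hderiv : deriv (fun ζ => deriv w ζ - d) z = deriv (deriv w) z := by
      rw [deriv_sub_const]
    rwa [hderiv] at h
  · calc ‖deriv w z‖ = ‖d + (deriv w z - d)‖ := by rw [add_sub_cancel]
      _ ≤ ‖d‖ + ‖deriv w z - d‖ := norm_add_le _ _
      _ ≤ ‖d‖ + q := by linarith [hq z hzS]

/-- **Local form of the second-derivative bound (the one the crux uses).**  `w` holomorphic on the `2hs`-stadium; at a point `z` of
the `hs`-stadium suppose the OSCILLATION bound `‖w′ ζ − w′ z‖ ≤ q` for `ζ ∈ B̄(z, hs)`.  Then `‖w″ z‖ ≤ q/hs`.  (In crux scaling `q` is the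
oscillation of the slip derivative over a disc of radius `hs = cs√Γ`, `q ∼ C·cs`, so `K₂ = q/hs ∼ C/√Γ` and the capstone's
`K₂(r₁ + hs) ≤ 1/4` is a smallness condition on `cs` and `r₁/√Γ`.  The global form `stadium_norm_second_deriv_le`, with ONE constant `d`
on the whole stadium, is not the source of `K₂` in the crux: there `w′` ranges over `[1/2, Λ]` along the trace, so its `q` exceeds `1/4`.)
[folklore: Cauchy] -/
theorem stadium_norm_second_deriv_le_local {hs L cc q : ℝ} {w : ℂ → ℂ}
    (hw : DifferentiableOn ℂ w {ζ : ℂ | |ζ.im| < 2 * hs ∧ |ζ.re - cc| < L + 2 * hs})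
    {z : ℂ} (hz : z ∈ {z : ℂ | |z.im| < hs ∧ |z.re - cc| < L + hs})
    (hq : ∀ ζ ∈ closedBall z hs, ‖deriv w ζ - deriv w z‖ ≤ q) : ‖deriv (deriv w) z‖ ≤ q / hs := by
  have hhs : 0 < hs := lt_of_le_of_lt (abs_nonneg _) hz.1
  have hSo : IsOpen {ζ : ℂ | |ζ.im| < 2 * hs ∧ |ζ.re - cc| < L + 2 * hs} := by
    have h1 : IsOpen {ζ : ℂ | |ζ.im| < 2 * hs} := isOpen_lt (continuous_abs.comp Complex.continuous_im) continuous_const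
    have h2 : IsOpen {ζ : ℂ | |ζ.re - cc| < L + 2 * hs} :=
      isOpen_lt (continuous_abs.comp (Complex.continuous_re.sub continuous_const)) continuous_const
    exact h1.inter h2
  have hsub := closedBall_subset_stadium_double hz
  have hw' : DifferentiableOn ℂ (deriv w) {ζ : ℂ | |ζ.im| < 2 * hs ∧ |ζ.re - cc| < L + 2 * hs} :=
    (hw.analyticOnNhd hSo).deriv.differentiableOn
  have hg : DifferentiableOn ℂ (fun ζ => deriv w ζ - deriv w z) {ζ : ℂ | |ζ.im| < 2 * hs ∧ |ζ.re - cc| < L + 2 * hs} :=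
    hw'.sub_const (deriv w z)
  have hd : DiffContOnCl ℂ (fun ζ => deriv w ζ - deriv w z) (ball z hs) := hg.diffContOnCl_ball hsub
  have h := Complex.norm_deriv_le_of_forall_mem_sphere_norm_le hhs hd
    (fun ζ hζ => hq ζ (sphere_subset_closedBall hζ))
  have hderiv : deriv (fun ζ => deriv w ζ - deriv w z) z = deriv (deriv w) z := by
    rw [deriv_sub_const]
  rwa [hderiv] at h

end Summit.NavierStokesRegularity.NavierStokesRegularity.Theorems.AreaLawSlavingHolo
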